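/-
Copyright (c) 2026 the pub-hodgecm-mathlib formalisation cell (harness21).  Prover seat hodgecm-mathlib-K2E5-p15 (g3), HCML Track B «K2-LIT»,
h413 = `stmt-HodgeConjecture-24833`, (SC-an) line (lead K2E3-p14 (g3)), road «HC-14-ell» (HC Thms 13∕14 for the compact Cartans of `𝔲(3)`), file E4
«THE `𝔲(2)` BASE CASE» (dealer K2E3-plan (g2) deal (D45) 2026-09-04T03:00Z; head = lead RULINGS #7 (R7-1) 03:03Z).  2026-09-04.
-/
import Literature.NumberTheory.Automorphic.UnitaryGroupAutomorphicRep      -- ★ `unitaryGroupOfForm`, `mem_unitaryGroupOfForm_iff`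
import Literature.NumberTheory.GaloisRepresentations.LocalField           -- ★ `IsNonarchimedeanLocalField.normAbs`
import Literature.NumberTheory.Automorphic.LocalFieldHaarBalls            -- ★ `LocalFieldHaar.continuous_normAbs`
import Mathlib.LinearAlgebra.Matrix.Charpoly.Disc
import Mathlib.Analysis.SpecialFunctions.Pow.Continuity
import Mathlib.MeasureTheory.Measure.Haar.Basic
import Summits.HodgeConjecture.HodgeConjecture.Theorems.K2E3HC14EllU11OrbitVolume   -- ED.2: FILE D (this seat) `exists_measure_conjEntryBall_le`; brings FILES A, A′, B, B′, C
import HarnessLib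

/-!
# h413 ∕ Track B «K2-LIT», (SC-an) line, road «HC-14-ell», file E4: HARISH-CHANDRA'S THEOREM 13 FOR `𝔲(2)` — THE COMPACT CARTAN SUBALGEBRAS
# §1 (E4-an): the ANISOTROPIC case — `U(σ, J)(K)` compact ⇒ `|disc χ_X|_K^{1∕4} · ∫_U Θ(g X g⁻¹) dg ≤ C · ‖Θ‖_∞` on every compact `ω ⊆ M₂(K)`

Cell `pub/hodgecm-mathlib`, crux H413 = `stmt-HodgeConjecture-24833` (lane `--supports … --as helper`, count-neutral); seat K2E5-p15 (g3); dealer K2E3-plan (g2)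
deal (D45); (SC-an) line lead K2E3-p14 (g3), whose RULINGS #7 (R7-1) fix this file's name, namespace, frame, currency and heads.  THEOREMS ONLY (no `def`, no
`instance`, no `notation`, no named-fact hypothesis, no `sorry`); never imports `Cruxes/…/Lines`.

THE ROAD.  «HC-14-ell» = HC Thms 13∕14 [HarishChandra1970, Part V §3 Thm. 13 p. 51, Part VI §8 Thm. 14 p. 60] for the COMPACT Cartan subalgebras `𝔥` of `𝔲(3)`
(via the global Cayley transport): `sup_{X ∈ 𝔥′ ∩ ω} |η(X)|^{1∕2} |Φ_f(X)| < ∞`.  Cut (lead RULINGS #5 (R5-2)): E1 stretching · E2 semisimple descent at type `(a,a,b)` to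
`𝔲(2) ⊕ 𝔲(1)` · E3 the crux near non-zero nilpotents · **E4 the `𝔲(2)` base case (this file)** · E5 transport.  In E2's descent the `𝔲(2)`-block is `𝔲(W₁)` for a
hermitian PLANE `W₁`, which is either ANISOTROPIC (`U(W₁)` compact) or ISOTROPIC (`W₁` hyperbolic, `U(W₁) = U(1,1)` quasi-split); both cases are needed.

CURRENCY (R7-1).  `K` a non-archimedean local field (the quadratic extension `E = L_w`; `σ` its involution), `U = ↥(unitaryGroupOfForm σ J)` (★
`UnitaryGroupAutomorphicRep`) for a `2 × 2` form `J`, the Lie algebra in MATRIX currency `(X.map σ)ᵀ * J + J * X = 0` (the predicate of ★ `CayleyChartUnitary(Model)` ∕ ★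
`HCDGroupToLie`; not restated as a definition), the orbital integral as a plain Haar integral over `U` (the Cartan is compact: no quotient measure, no `descConj`),
and the TOKEN `((↑|disc χ_X|_K : ℝ≥0∞)) ^ (1∕4)` = HC's `|η(X)|_F^{1∕2}` (`η(X) = −(ξ₁ − ξ₂)²`, `|z|_E = |z|_F²`) = the ε-road's `eta_rpow` convention at `r = −1∕4` = (M5e)'s
`T(g) = |discr|^{1∕4}` — ONE normalisation across the (SC-an) cone.

* §1 (E4-an, this edition) **`exists_const_rpow_quarter_mul_lintegral_conj_le_of_compactSpace`** — if `U(σ, J)(K)` is COMPACT (the anisotropic plane) then for every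
  compact `ω ⊆ M₂(K)` there is ONE `C` with `|disc χ_X|_K^{1∕4} · ∫⁻_U Θ(g X g⁻¹) dμ ≤ C · M` for every measurable `Θ ≤ M` and every `X ∈ ω` (regular or not; no
  support condition is needed): the token is CONTINUOUS on `M₂(K)` (Mathlib `Matrix.discr_fin_two`: `disc χ_X = (tr X)² − 4 det X`; ★ `continuous_normAbs`), hence
  bounded on `ω`, and `∫⁻_U Θ ≤ M · μ(U)` with `μ(U) < ∞`.
* §2 (E4-iso, next edition) `exists_const_rpow_quarter_mul_lintegral_conj_le` — the quasi-split `U(1,1)`, `Y` regular ELLIPTIC, `ω` compact inside the compact Cartan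
  `𝔥 = 𝔷 ⊕ F·Y`, `Θ` supported in a fixed compact `S`: HC Thm 13 for `𝔰𝔩₂`-type by the Iwasawa decomposition `U = B·K₀` (★ `HermitianLattice.exists_eq_upper_mul_unitaryInt`),
  ★ `HaarHK.eq_smul_map_prod`, the ★ `LineRing` kit of `U(σ, Φ₂)`, and the completed square of `χ_Y` along the line `y₁₁ + y₁₀·R⁻`.

HONEST LABEL.  HC_CM is proved only modulo the 7 printed citations (2 remaining named inputs: hLiu418 = `stmt-HodgeConjecture-24832`, h413 =
`stmt-HodgeConjecture-24833`) until rung 0 closes; count-neutral helper of the residual road «HC-14-ell» of (SC-dom); (SC-an) is NOT ★.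

## References
* [HarishChandra1970] Harish-Chandra (notes by G. van Dijk), *Harmonic Analysis on Reductive p-adic Groups*, LNM 162 (1970), Part V §3 Thm. 13 p. 51; Part VI §8
  Thm. 14 p. 60; Part VII §3 pp. 71–73.
* [Rogawski1990] J. D. Rogawski, *Automorphic Representations of Unitary Groups in Three Variables*, Ann. of Math. Stud. 123 (1990), §3.6 pp. 28–31 (Cartan subgroups
  of `U(2)`, `U(3)`), §4.9 p. 54 (`D_G`), §12.5 p. 182.
* [Kottwitz1988] R. E. Kottwitz, *Tamagawa numbers*, Ann. of Math. 127 (1988), §2 (anisotropic groups are compact; orbital integrals on compact groups).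
-/

set_option autoImplicit false
set_option linter.dupNamespace false  -- the mandated namespace repeats the single-problem summit's segment (`HodgeConjecture.HodgeConjecture`)

noncomputable section

open MeasureTheory Measure Set Filter Topology Matrix
open scoped ENNReal NNReal MatrixGroups
open Literature.NumberTheory.Automorphic Literature.NumberTheory.GaloisRepresentations
open Literature.NumberTheory.GaloisRepresentations.IsNonarchimedeanLocalField Literature.NumberTheory.Automorphic.LocalFieldHaar

namespace Summit.HodgeConjecture.HodgeConjecture.Cruxes.H413.K2E3HC14EllBaseCaseU2

/-! ## §0 The token `X ↦ |disc χ_X|_K^{1∕4}` is continuous on `M₂(K)`, hence bounded on compacta -/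

section Token

variable {K : Type*} [Field K] [ValuativeRel K] [TopologicalSpace K] [IsNonarchimedeanLocalField K]

/-- `X ↦ disc χ_X = (tr X)² − 4 det X` is continuous on `M₂(K)` (Mathlib `Matrix.discr_fin_two`). [cite: Rogawski1990, §4.9 p. 54] -/
theorem continuous_charpoly_discr_two : Continuous fun X : Matrix (Fin 2) (Fin 2) K => (Matrix.charpoly X).discr := by
  haveI : IsTopologicalRing K := inferInstance
  have h : (fun X : Matrix (Fin 2) (Fin 2) K => (Matrix.charpoly X).discr) = fun X => X.trace ^ 2 - 4 * X.det := by
    funext X; exact Matrix.discr_fin_two X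
  rw [h]
  exact ((continuous_id.matrix_trace).pow 2).sub (continuous_const.mul continuous_id.matrix_det)

/-- **The token `X ↦ (↑|disc χ_X|_K)^{1∕4}` is continuous on `M₂(K)`** (`ENNReal.continuous_rpow_const` ∘ coercion ∘ ★ `continuous_normAbs` ∘ `continuous_charpoly_discr_two`).
[cite: HarishChandra1970, Part V §3 Thm. 13 p. 51] -/
theorem continuous_token_two :
    Continuous fun X : Matrix (Fin 2) (Fin 2) K => ((normAbs K (Matrix.charpoly X).discr : ℝ≥0∞)) ^ (1 / 4 : ℝ) :=
  ENNReal.continuous_rpow_const.comp (ENNReal.continuous_coe.comp (continuous_normAbs.comp continuous_charpoly_discr_two))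

/-- On a compact `ω ⊆ M₂(K)` the token is bounded by a finite constant: `∃ B : ℝ≥0, ∀ X ∈ ω, (↑|disc χ_X|_K)^{1∕4} ≤ B`. [cite: HarishChandra1970, Part V §3 Thm. 13 p. 51] -/
theorem exists_token_le_of_isCompact {ω : Set (Matrix (Fin 2) (Fin 2) K)} (hω : IsCompact ω) :
    ∃ B : ℝ≥0, ∀ X ∈ ω, ((normAbs K (Matrix.charpoly X).discr : ℝ≥0∞)) ^ (1 / 4 : ℝ) ≤ B := by
  obtain ⟨B, hB⟩ := hω.bddAbove_image (f := fun X : Matrix (Fin 2) (Fin 2) K => normAbs K (Matrix.charpoly X).discr)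
    (continuous_normAbs.comp continuous_charpoly_discr_two).continuousOn
  refine ⟨B ^ (1 / 4 : ℝ), fun X hX => ?_⟩
  rw [ENNReal.coe_rpow_of_nonneg _ (by norm_num : (0 : ℝ) ≤ 1 / 4)]
  exact ENNReal.rpow_le_rpow (ENNReal.coe_le_coe.2 (hB ⟨X, hX, rfl⟩)) (by norm_num)

end Token

/-! ## §1 (E4-an) The anisotropic plane: `U(σ, J)(K)` compact -/

section Anisotropic

variable {K : Type*} [Field K] [ValuativeRel K] [TopologicalSpace K] [IsNonarchimedeanLocalField K] [MeasurableSpace (Matrix (Fin 2) (Fin 2) K)]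
  (σ : K →+* K) (J : Matrix (Fin 2) (Fin 2) K)
  [MeasurableSpace ↥(unitaryGroupOfForm σ J)] (μ : Measure ↥(unitaryGroupOfForm σ J)) [IsFiniteMeasure μ]

/-- **(E4-an) HC THM 13 FOR `𝔲(2)` OF AN ANISOTROPIC PLANE.**  If `U = U(σ, J)(K)` is compact — so that its Haar measures are FINITE, which is the only property of `μ` used — then
for every compact `ω ⊆ M₂(K)` there is ONE constant `C` such that for every measurable `Θ : M₂(K) → [0, ∞]` bounded by `M` (supported anywhere) and every `X ∈ ω` with
`disc χ_X ≠ 0`:  `(↑|disc χ_X|_K)^{1∕4} · ∫⁻_U Θ(g X g⁻¹) dμ(g) ≤ C · M`.  (The binders `Measurable Θ`, the support set `S` and `disc χ_X ≠ 0` are kept only to give §1 the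
same consumer shape as §2; they are not used.)  Proof: the token is `≤ B` on `ω` (§0) and `∫⁻ Θ ≤ M · μ(U)`; `C = B · μ(U)`.
[cite: HarishChandra1970, Part V §3 Thm. 13 p. 51; Part VI §8 Thm. 14 p. 60] [cite: Kottwitz1988, §2] -/
theorem exists_const_rpow_quarter_mul_lintegral_conj_le_of_compactSpace
    {ω : Set (Matrix (Fin 2) (Fin 2) K)} (hω : IsCompact ω) (S : Set (Matrix (Fin 2) (Fin 2) K)) :
    ∃ C : ℝ≥0, ∀ Θ : Matrix (Fin 2) (Fin 2) K → ℝ≥0∞, Measurable Θ → (∀ X, Θ X ≠ 0 → X ∈ S) → ∀ M : ℝ≥0∞, (∀ X, Θ X ≤ M) →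
      ∀ X ∈ ω, (Matrix.charpoly X).discr ≠ 0 →
        ((normAbs K (Matrix.charpoly X).discr : ℝ≥0∞)) ^ (1 / 4 : ℝ) *
            ∫⁻ g, Θ (((g : GL (Fin 2) K) : Matrix (Fin 2) (Fin 2) K) * X * (((g : GL (Fin 2) K)⁻¹ : GL (Fin 2) K) : Matrix (Fin 2) (Fin 2) K)) ∂μ ≤
          C * M := by
  obtain ⟨B, hB⟩ := exists_token_le_of_isCompact (K := K) hω
  refine ⟨B * (μ univ).toNNReal, fun Θ _ _ M hΘM X hX _ => ?_⟩
  have hint : ∫⁻ g, Θ (((g : GL (Fin 2) K) : Matrix (Fin 2) (Fin 2) K) * X * (((g : GL (Fin 2) K)⁻¹ : GL (Fin 2) K) : Matrix (Fin 2) (Fin 2) K)) ∂μ ≤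
      M * μ univ := by
    calc ∫⁻ g, Θ (((g : GL (Fin 2) K) : Matrix (Fin 2) (Fin 2) K) * X * (((g : GL (Fin 2) K)⁻¹ : GL (Fin 2) K) : Matrix (Fin 2) (Fin 2) K)) ∂μ
        ≤ ∫⁻ _g, M ∂μ := lintegral_mono fun g => hΘM _
      _ = M * μ univ := lintegral_const M
  calc ((normAbs K (Matrix.charpoly X).discr : ℝ≥0∞)) ^ (1 / 4 : ℝ) *
        ∫⁻ g, Θ (((g : GL (Fin 2) K) : Matrix (Fin 2) (Fin 2) K) * X * (((g : GL (Fin 2) K)⁻¹ : GL (Fin 2) K) : Matrix (Fin 2) (Fin 2) K)) ∂μ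
      ≤ (B : ℝ≥0∞) * (M * μ univ) := mul_le_mul' (hB X hX) hint
    _ = ((B * (μ univ).toNNReal : ℝ≥0) : ℝ≥0∞) * M := by
        rw [ENNReal.coe_mul, ENNReal.coe_toNNReal (measure_ne_top μ _)]; ring

/-- **(E4-an) for a HAAR measure on a compact `U(σ, J)(K)`** (the (R7-1) frame: `[CompactSpace U]`, `μ` a Haar measure — finite on the compact `univ`).
[cite: HarishChandra1970, Part V §3 Thm. 13 p. 51] [cite: Kottwitz1988, §2] -/
theorem exists_const_rpow_quarter_mul_lintegral_conj_le_of_compactSpace_haar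
    [TopologicalSpace.PseudoMetrizableSpace ↥(unitaryGroupOfForm σ J)] [BorelSpace ↥(unitaryGroupOfForm σ J)] [CompactSpace ↥(unitaryGroupOfForm σ J)]
    (ν : Measure ↥(unitaryGroupOfForm σ J)) [ν.IsHaarMeasure]
    {ω : Set (Matrix (Fin 2) (Fin 2) K)} (hω : IsCompact ω) (S : Set (Matrix (Fin 2) (Fin 2) K)) :
    ∃ C : ℝ≥0, ∀ Θ : Matrix (Fin 2) (Fin 2) K → ℝ≥0∞, Measurable Θ → (∀ X, Θ X ≠ 0 → X ∈ S) → ∀ M : ℝ≥0∞, (∀ X, Θ X ≤ M) →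
      ∀ X ∈ ω, (Matrix.charpoly X).discr ≠ 0 →
        ((normAbs K (Matrix.charpoly X).discr : ℝ≥0∞)) ^ (1 / 4 : ℝ) *
            ∫⁻ g, Θ (((g : GL (Fin 2) K) : Matrix (Fin 2) (Fin 2) K) * X * (((g : GL (Fin 2) K)⁻¹ : GL (Fin 2) K) : Matrix (Fin 2) (Fin 2) K)) ∂ν ≤
          C * M := by
  haveI : IsFiniteMeasure ν := CompactSpace.isFiniteMeasure
  exact exists_const_rpow_quarter_mul_lintegral_conj_le_of_compactSpace σ J ν hω S

end Anisotropic

/-! ## §2 (E4-iso, ED.2) The isotropic plane: `U(σ, Φ₂)(K) = U(1,1)`, `Y` regular ELLIPTIC, `ω ⊆ 𝔥_Y = K·1 + K·Y ∩ 𝔲` compact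

THE ESTIMATE (HC Thm 13 for `𝔰𝔩₂`-type, by hand).  Every `X` commuting with the regular `Y` is `X = a·1 + b·Y` (`b = x₁₀ ∕ y₁₀`, `y₁₀ ≠ 0` by ellipticity, FILE A′), so
`g X g⁻¹ = a·1 + b·(g Y g⁻¹)` and `disc χ_X = b²·disc χ_Y`; the token is `|b|^{1∕2}·|disc χ_Y|^{1∕4}`.  If `Θ(g⁻¹ X g) ≠ 0` then `g⁻¹ X g ∈ S`, so every entry of
`b·(g⁻¹ Y g) = g⁻¹Xg − a·1` has `|·|_K ≤ R₁ := max A_S A₀` (ultrametric; `A_S` bounds the entries on `S`, `A₀` bounds `|a|` on `ω`).  Hence, after passing to `g⁻¹ X g`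
(FILE B: `U(1,1)` is unimodular), `∫⁻ Θ(gXg⁻¹) ≤ M · μ{g : |b (g⁻¹Yg)ᵢⱼ| ≤ R₁ ∀ i j} ≤ M · C_D · |b|^{-1∕2}` by THE VOLUME LEMMA (FILE D), and the token cancels `|b|^{∓1∕2}`:
`C := C_D · |disc χ_Y|^{1∕4}`.  Gluing over the finitely many classes of compact Cartans is (E4-fin) ★ `K2E3U2CompactCartanClasses` (lead RULINGS #11 (R11-2), default). -/

section IsotropicPrelim

variable {K : Type*} [Field K]

/-- The centraliser of a `2 × 2` matrix `Y` with `y₁₀ ≠ 0` is `K·1 + K·Y`, with explicit coefficients: `X = (x₁₁ − (x₁₀∕y₁₀)·y₁₁)·1 + (x₁₀∕y₁₀)·Y`.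
[cite: HarishChandra1970, Part V §3 Thm. 13 p. 51] -/
theorem eq_smul_one_add_smul_of_mul_comm {X Y : Matrix (Fin 2) (Fin 2) K} (h : X * Y = Y * X) (hy : Y 1 0 ≠ 0) :
    X = (X 1 1 - X 1 0 / Y 1 0 * Y 1 1) • (1 : Matrix (Fin 2) (Fin 2) K) + (X 1 0 / Y 1 0) • Y := by
  have h10 := congrFun (congrFun h 1) 0
  have h00 := congrFun (congrFun h 0) 0
  simp only [Matrix.mul_apply, Fin.sum_univ_two] at h10 h00
  ext i j
  fin_cases i <;> fin_cases j <;>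
    simp only [Matrix.add_apply, Matrix.smul_apply, smul_eq_mul, Fin.zero_eta, Fin.mk_one, Fin.isValue, Matrix.one_apply_eq,
      Matrix.one_apply_ne (show (0 : Fin 2) ≠ 1 by decide), Matrix.one_apply_ne (show (1 : Fin 2) ≠ 0 by decide), mul_one, mul_zero, zero_add]
  · field_simp
    linear_combination -h10
  · field_simp
    linear_combination h00
  · field_simp
  · ring

/-- Conjugation fixes the scalar part: `g⁻¹ (a·1 + b·Y) g = a·1 + b·(g⁻¹ Y g)`. [cite: HarishChandra1970, Part V §3 Thm. 13 p. 51] -/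
theorem units_inv_mul_smul_one_add_smul_mul (g : GL (Fin 2) K) (a b : K) (Y : Matrix (Fin 2) (Fin 2) K) :
    ((g⁻¹ : GL (Fin 2) K) : Matrix (Fin 2) (Fin 2) K) * (a • (1 : Matrix (Fin 2) (Fin 2) K) + b • Y) * (g : Matrix (Fin 2) (Fin 2) K) =
      a • (1 : Matrix (Fin 2) (Fin 2) K) + b • (((g⁻¹ : GL (Fin 2) K) : Matrix (Fin 2) (Fin 2) K) * Y * (g : Matrix (Fin 2) (Fin 2) K)) := by
  rw [Matrix.mul_add, Matrix.add_mul, Matrix.mul_smul, Matrix.smul_mul, Matrix.mul_one, Matrix.mul_smul, Matrix.smul_mul]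
  congr 2
  exact Units.inv_mul g

/-- `disc χ_{a·1 + b·Y} = b² · disc χ_Y` (`disc χ = tr² − 4 det` on `M₂`, Mathlib `Matrix.discr_fin_two`). [cite: HarishChandra1970, Part V §3 Thm. 13 p. 51] -/
theorem charpoly_discr_smul_one_add_smul (a b : K) (Y : Matrix (Fin 2) (Fin 2) K) :
    (Matrix.charpoly (a • (1 : Matrix (Fin 2) (Fin 2) K) + b • Y)).discr = b ^ 2 * (Matrix.charpoly Y).discr := by
  have h1 := Matrix.discr_fin_two (a • (1 : Matrix (Fin 2) (Fin 2) K) + b • Y)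
  have h2 := Matrix.discr_fin_two Y
  rw [Matrix.discr] at h1 h2
  rw [h1, h2, Matrix.trace_fin_two, Matrix.det_fin_two, Matrix.trace_fin_two, Matrix.det_fin_two]
  simp only [Matrix.add_apply, Matrix.smul_apply, Matrix.one_apply, smul_eq_mul]
  simp
  ring

/-- The token of `b²·D`: `(↑(|b|² · |D|))^{1∕4} = ↑√|b| · (↑|D|)^{1∕4}` in `ℝ≥0∞`. [cite: HarishChandra1970, Part V §3 Thm. 13 p. 51] -/
theorem coe_sq_mul_rpow_quarter (x y : ℝ≥0) :
    (((x ^ 2 * y : ℝ≥0)) : ℝ≥0∞) ^ (1 / 4 : ℝ) = (NNReal.sqrt x : ℝ≥0∞) * ((y : ℝ≥0∞)) ^ (1 / 4 : ℝ) := by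
  rw [ENNReal.coe_mul, ENNReal.mul_rpow_of_nonneg _ _ (by norm_num), ENNReal.coe_pow, ← ENNReal.rpow_natCast, ← ENNReal.rpow_mul]
  congr 1
  rw [NNReal.sqrt_eq_rpow, ENNReal.coe_rpow_of_nonneg _ (by norm_num)]
  norm_num

end IsotropicPrelim

section IsotropicBounds

variable {K : Type*} [Field K] [ValuativeRel K] [TopologicalSpace K] [IsNonarchimedeanLocalField K]

/-- On a compact `S ⊆ M₂(K)` all entries are bounded: `∃ A, ∀ X ∈ S, ∀ i j, |X i j|_K ≤ A` (★ `continuous_normAbs`). [cite: HarishChandra1970, Part V §3 Thm. 13 p. 51] -/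
theorem exists_normAbs_apply_le_of_isCompact {S : Set (Matrix (Fin 2) (Fin 2) K)} (hS : IsCompact S) :
    ∃ A : ℝ≥0, ∀ X ∈ S, ∀ i j, normAbs K (X i j) ≤ A := by
  have hc : Continuous fun X : Matrix (Fin 2) (Fin 2) K => ∑ i, ∑ j, normAbs K (X i j) :=
    continuous_finsetSum _ fun i _ => continuous_finsetSum _ fun j _ => continuous_normAbs.comp (continuous_id.matrix_elem i j)
  obtain ⟨A, hA⟩ := hS.bddAbove_image hc.continuousOn
  refine ⟨A, fun X hX i j => le_trans ?_ (hA ⟨X, hX, rfl⟩)⟩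
  calc normAbs K (X i j) ≤ ∑ j', normAbs K (X i j') := Finset.single_le_sum (f := fun j' => normAbs K (X i j')) (fun _ _ => bot_le) (Finset.mem_univ j)
    _ ≤ ∑ i', ∑ j', normAbs K (X i' j') := Finset.single_le_sum (f := fun i' => ∑ j', normAbs K (X i' j')) (fun _ _ => bot_le) (Finset.mem_univ i)

/-- The entry bound behind the support reduction: if `Z = a·1 + b·W` has all `|Z i j|_K ≤ A` and `|a|_K ≤ A'` then all `|b·W i j|_K ≤ max A A'` (ultrametric ★ `normAbs_add_le_max`).
[cite: HarishChandra1970, Part V §3 Thm. 13 p. 51] -/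
theorem normAbs_mul_apply_le_max_of_eq_smul_one_add_smul {Z W : Matrix (Fin 2) (Fin 2) K} {a b : K} (hZ : Z = a • (1 : Matrix (Fin 2) (Fin 2) K) + b • W)
    {A A' : ℝ≥0} (hA : ∀ i j, normAbs K (Z i j) ≤ A) (hA' : normAbs K a ≤ A') (i j : Fin 2) : normAbs K (b * W i j) ≤ max A A' := by
  have h : b * W i j = Z i j + -(a * (1 : Matrix (Fin 2) (Fin 2) K) i j) := by
    rw [hZ]; simp only [Matrix.add_apply, Matrix.smul_apply, smul_eq_mul]; ring
  rw [h]
  refine (normAbs_add_le_max _ _).trans (max_le_max (hA i j) ?_)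
  rw [normAbs_neg, map_mul]
  refine le_trans ?_ hA'
  rcases eq_or_ne i j with hij | hij
  · rw [hij, Matrix.one_apply_eq, map_one, mul_one]
  · rw [Matrix.one_apply_ne hij, map_zero, mul_zero]; exact bot_le

end IsotropicBounds

section Isotropic

open ValuativeRel Literature.NumberTheory.Automorphic.UnitaryGroup Literature.NumberTheory.Automorphic.HermitianLattice
open Summit.HodgeConjecture.HodgeConjecture.Cruxes.H413.K2E3HC14EllU11Elliptic Summit.HodgeConjecture.HodgeConjecture.Cruxes.H413.K2E3HC14EllU11Haar
open Summit.HodgeConjecture.HodgeConjecture.Cruxes.H413.K2E3HC14EllU11OrbitVolume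
open scoped WithZero

variable {K : Type*} [Field K] [Valued K ℤᵐ⁰] [ValuativeRel K] [(Valued.v : Valuation K ℤᵐ⁰).Compatible] [IsNonarchimedeanLocalField K]
  [MeasurableSpace K] [BorelSpace K] [MeasurableSpace (Matrix (Fin 2) (Fin 2) K)]
  (σ : K →+* K) (hσ : ∀ x, σ (σ x) = x) (hσv : ∀ x, Valued.v (σ x) = Valued.v x)
  {J : Matrix (Fin 2) (Fin 2) K} (hJ : J = (StdForm.antidiagonal 2).over K)
  [MeasurableSpace ↥(unitaryGroupOfForm σ J)] [BorelSpace ↥(unitaryGroupOfForm σ J)]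

include hσ hσv hJ in
/-- **(E4-iso) HARISH-CHANDRA'S THEOREM 13 FOR THE COMPACT CARTAN SUBALGEBRAS OF `𝔲(1,1) = 𝔲(σ, Φ₂)(K)`** (the lead's (R7-1) head, per-Cartan form; glue by (E4-fin)).
`K` a non-archimedean local field with isometric involution `σ` (`v ∘ σ = v`, a `σ`-skew unit exists, `2 ≠ 0`), `J = Φ₂`, `μ` ANY Haar measure on `U = U(σ, J)(K)`,
`Y ∈ 𝔲` regular (`disc χ_Y ≠ 0`) and ELLIPTIC (compact centraliser in `U`), `ω ⊆ 𝔥_Y = {X ∈ 𝔲 : XY = YX}` compact, `S ⊆ M₂(K)` compact.  Then there is ONE constant `C`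
such that for every measurable `Θ : M₂(K) → [0, ∞]` supported in `S` and bounded by `M`, and every regular `X ∈ ω`:
`(↑|disc χ_X|_K)^{1∕4} · ∫⁻_U Θ(g X g⁻¹) dμ(g) ≤ C · M`.
Proof: §2 preamble — `X = a·1 + b·Y` (`eq_smul_one_add_smul_of_mul_comm`, FILE A′ `apply_one_zero_ne_zero_of_isCompact_centralizer`), `disc χ_X = b² disc χ_Y`
(`charpoly_discr_smul_one_add_smul`), unimodularity (FILE B `lintegral_conj_eq_lintegral_inv_conj`), support ⇒ entry ball (`normAbs_mul_apply_le_max_of_eq_smul_one_add_smul`),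
THE VOLUME LEMMA (FILE D `exists_measure_conjEntryBall_le`), and `√|b| · (√|b|)⁻¹ = 1`.
[cite: HarishChandra1970, Part V §3 Thm. 13 p. 51; Part VI §8 Thm. 14 p. 60] [cite: Rogawski1990, §3.6 pp. 28–31; §4.9 p. 54] -/
theorem exists_const_rpow_quarter_mul_lintegral_conj_le (h2 : (2 : K) ≠ 0) (hskew : ∃ δ : K, δ ≠ 0 ∧ σ δ = -δ)
    (μ : Measure ↥(unitaryGroupOfForm σ J)) [μ.IsHaarMeasure]
    (Y : Matrix (Fin 2) (Fin 2) K) (hY : (Y.map σ)ᵀ * J + J * Y = 0) (hYreg : (Matrix.charpoly Y).discr ≠ 0)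
    (hYell : IsCompact {g : ↥(unitaryGroupOfForm σ J) |
      ((g : GL (Fin 2) K) : Matrix (Fin 2) (Fin 2) K) * Y * (((g : GL (Fin 2) K)⁻¹ : GL (Fin 2) K) : Matrix (Fin 2) (Fin 2) K) = Y})
    {ω : Set (Matrix (Fin 2) (Fin 2) K)} (hω : IsCompact ω) (hω𝔥 : ∀ X ∈ ω, (X.map σ)ᵀ * J + J * X = 0 ∧ X * Y = Y * X)
    {S : Set (Matrix (Fin 2) (Fin 2) K)} (hS : IsCompact S) :
    ∃ C : ℝ≥0, ∀ Θ : Matrix (Fin 2) (Fin 2) K → ℝ≥0∞, Measurable Θ → (∀ X, Θ X ≠ 0 → X ∈ S) → ∀ M : ℝ≥0∞, (∀ X, Θ X ≤ M) →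
      ∀ X ∈ ω, (Matrix.charpoly X).discr ≠ 0 →
        ((normAbs K (Matrix.charpoly X).discr : ℝ≥0∞)) ^ (1 / 4 : ℝ) *
            ∫⁻ g, Θ (((g : GL (Fin 2) K) : Matrix (Fin 2) (Fin 2) K) * X * (((g : GL (Fin 2) K)⁻¹ : GL (Fin 2) K) : Matrix (Fin 2) (Fin 2) K)) ∂μ ≤
          C * M := by
  haveI : LocallyCompactSpace ↥(unitaryGroupOfForm σ J) := locallyCompactSpace_unitary (continuous_of_forall_v_eq hσv) J
  -- ellipticity ⇒ `y₁₀ ≠ 0`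
  have hy10 : Y 1 0 ≠ 0 := apply_one_zero_ne_zero_of_isCompact_centralizer σ hσ hJ hY hYreg hYell
  have hy10' : 0 < normAbs K (Y 1 0) := pos_iff_ne_zero.2 ((_root_.map_ne_zero (normAbs K)).2 hy10)
  -- the entry bounds on `S` and on `ω`
  obtain ⟨AS, hAS⟩ := exists_normAbs_apply_le_of_isCompact (K := K) hS
  obtain ⟨Aω, hAω⟩ := exists_normAbs_apply_le_of_isCompact (K := K) hω
  set A₀ : ℝ≥0 := max Aω (Aω / normAbs K (Y 1 0) * normAbs K (Y 1 1)) with hA₀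
  set R₁ : ℝ≥0 := max AS A₀ with hR₁
  -- THE VOLUME LEMMA at radius `R₁`
  obtain ⟨CD, hCD⟩ := exists_measure_conjEntryBall_le σ hσ hσv hJ h2 hskew μ hY hYreg hYell R₁
  set D4 : ℝ≥0 := (normAbs K (Matrix.charpoly Y).discr) ^ (1 / 4 : ℝ) with hD4
  have hD4c : ((normAbs K (Matrix.charpoly Y).discr : ℝ≥0∞)) ^ (1 / 4 : ℝ) = (D4 : ℝ≥0∞) := by
    rw [hD4, ENNReal.coe_rpow_of_nonneg _ (by norm_num)]
  refine ⟨CD * D4, fun Θ _ hΘS M hΘM X hX hdisc => ?_⟩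
  -- `X = a·1 + b·Y`
  set b : K := X 1 0 / Y 1 0 with hb
  set a : K := X 1 1 - X 1 0 / Y 1 0 * Y 1 1 with ha
  have hXab : X = a • (1 : Matrix (Fin 2) (Fin 2) K) + b • Y := eq_smul_one_add_smul_of_mul_comm (hω𝔥 X hX).2 hy10
  -- the token
  have hdiscX : (Matrix.charpoly X).discr = b ^ 2 * (Matrix.charpoly Y).discr := by
    conv_lhs => rw [hXab]
    exact charpoly_discr_smul_one_add_smul a b Y
  have hb0 : b ≠ 0 := by
    rintro hb0
    rw [hdiscX, hb0, zero_pow two_ne_zero, zero_mul] at hdisc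
    exact hdisc rfl
  have hsb : 0 < NNReal.sqrt (normAbs K b) := NNReal.sqrt_pos.2 (pos_iff_ne_zero.2 ((_root_.map_ne_zero (normAbs K)).2 hb0))
  have htoken : ((normAbs K (Matrix.charpoly X).discr : ℝ≥0∞)) ^ (1 / 4 : ℝ) = (NNReal.sqrt (normAbs K b) : ℝ≥0∞) * (D4 : ℝ≥0∞) := by
    rw [hdiscX, map_mul, map_pow, coe_sq_mul_rpow_quarter, hD4c]
  -- `|a|_K ≤ A₀`
  have hbn : normAbs K b ≤ Aω / normAbs K (Y 1 0) := by
    rw [hb, map_div₀]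
    exact div_le_div_of_nonneg_right (hAω X hX 1 0) hy10'.le
  have haA₀ : normAbs K a ≤ A₀ := by
    rw [ha, sub_eq_add_neg]
    refine (normAbs_add_le_max _ _).trans (max_le_max (hAω X hX 1 1) ?_)
    rw [normAbs_neg, map_mul]
    exact mul_le_mul' hbn le_rfl
  -- support ⇒ entry ball
  set E : Set ↥(unitaryGroupOfForm σ J) := {g | ∀ i j,
      normAbs K (b * ((((g : GL (Fin 2) K)⁻¹ : GL (Fin 2) K) : Matrix (Fin 2) (Fin 2) K) * Y * ((g : GL (Fin 2) K) : Matrix (Fin 2) (Fin 2) K)) i j) ≤ R₁} with hE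
  have hball : ∀ g : ↥(unitaryGroupOfForm σ J),
      Θ ((((g : GL (Fin 2) K)⁻¹ : GL (Fin 2) K) : Matrix (Fin 2) (Fin 2) K) * X * ((g : GL (Fin 2) K) : Matrix (Fin 2) (Fin 2) K)) ≤ E.indicator (fun _ => M) g := by
    intro g
    by_cases hz : Θ ((((g : GL (Fin 2) K)⁻¹ : GL (Fin 2) K) : Matrix (Fin 2) (Fin 2) K) * X * ((g : GL (Fin 2) K) : Matrix (Fin 2) (Fin 2) K)) = 0
    · rw [hz]; exact bot_le
    have hgE : g ∈ E := by
      have hZS := hΘS _ hz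
      have hZ : (((g : GL (Fin 2) K)⁻¹ : GL (Fin 2) K) : Matrix (Fin 2) (Fin 2) K) * X * ((g : GL (Fin 2) K) : Matrix (Fin 2) (Fin 2) K) =
          a • (1 : Matrix (Fin 2) (Fin 2) K) + b • ((((g : GL (Fin 2) K)⁻¹ : GL (Fin 2) K) : Matrix (Fin 2) (Fin 2) K) * Y * ((g : GL (Fin 2) K) : Matrix (Fin 2) (Fin 2) K)) := by
        conv_lhs => rw [hXab]
        exact units_inv_mul_smul_one_add_smul_mul _ a b Y
      rw [hE, Set.mem_setOf_eq]
      intro i j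
      exact normAbs_mul_apply_le_max_of_eq_smul_one_add_smul hZ (fun i j => hAS _ hZS i j) haA₀ i j
    rw [Set.indicator_of_mem hgE]
    exact hΘM _
  -- the integral bound
  have hint : ∫⁻ g, Θ (((g : GL (Fin 2) K) : Matrix (Fin 2) (Fin 2) K) * X * (((g : GL (Fin 2) K)⁻¹ : GL (Fin 2) K) : Matrix (Fin 2) (Fin 2) K)) ∂μ ≤
      M * ((CD : ℝ≥0∞) * (((NNReal.sqrt (normAbs K b))⁻¹ : ℝ≥0) : ℝ≥0∞)) := by
    rw [lintegral_conj_eq_lintegral_inv_conj σ hσ hσv hJ μ Θ X]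
    calc ∫⁻ g, Θ ((((g : GL (Fin 2) K)⁻¹ : GL (Fin 2) K) : Matrix (Fin 2) (Fin 2) K) * X * ((g : GL (Fin 2) K) : Matrix (Fin 2) (Fin 2) K)) ∂μ
        ≤ ∫⁻ g, E.indicator (fun _ => M) g ∂μ := lintegral_mono hball
      _ ≤ M * μ E := lintegral_indicator_const_le _ _
      _ ≤ M * ((CD : ℝ≥0∞) * (((NNReal.sqrt (normAbs K b))⁻¹ : ℝ≥0) : ℝ≥0∞)) := mul_le_mul' le_rfl (hCD b hb0)
  -- assemble: the token cancels `√|b|`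
  have hss : NNReal.sqrt (normAbs K b) * (NNReal.sqrt (normAbs K b))⁻¹ = 1 := mul_inv_cancel₀ hsb.ne'
  calc ((normAbs K (Matrix.charpoly X).discr : ℝ≥0∞)) ^ (1 / 4 : ℝ) *
        ∫⁻ g, Θ (((g : GL (Fin 2) K) : Matrix (Fin 2) (Fin 2) K) * X * (((g : GL (Fin 2) K)⁻¹ : GL (Fin 2) K) : Matrix (Fin 2) (Fin 2) K)) ∂μ
      ≤ ((NNReal.sqrt (normAbs K b) : ℝ≥0∞) * (D4 : ℝ≥0∞)) * (M * ((CD : ℝ≥0∞) * (((NNReal.sqrt (normAbs K b))⁻¹ : ℝ≥0) : ℝ≥0∞))) := by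
        rw [htoken]; exact mul_le_mul' le_rfl hint
    _ = ((NNReal.sqrt (normAbs K b) * (NNReal.sqrt (normAbs K b))⁻¹ : ℝ≥0) : ℝ≥0∞) * (((CD * D4 : ℝ≥0) : ℝ≥0∞) * M) := by
        push_cast; ring
    _ = ((CD * D4 : ℝ≥0) : ℝ≥0∞) * M := by rw [hss, ENNReal.coe_one, one_mul]

end Isotropic

end Summit.HodgeConjecture.HodgeConjecture.Cruxes.H413.K2E3HC14EllBaseCaseU2

end
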